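import Summits.CriticalPhenomena.PercolationContinuityZ3.Theorems.SahiMasterFamilyStructMain
import Summits.CriticalPhenomena.PercolationContinuityZ3.Theorems.SahiMasterFamilyTrichotomy

/-!
# Private gluing of zero flags, I: hull algebra of glued events, frame agreement, the coordinate shrink, order two

Unit `prim-master-conj` (crux anchor stmt-CriticalPhenomena-4575), gen 7.  Preliminaries for `SahiMasterFamilyPrivateGluing.lean`
(the zero-flag class `Z_k` is closed under private gluing = Lemma P at every order):
* glued events `A ∪ (B ∩ [e open])`: acting coordinates (`affects_glue`), hulls and annihilators over `e`-free coordinate sets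
  (`hull_glue`, `annihilator_glue_subset`), every increasing event is glued from its two `e`-sections (`eq_secAt_glue`); frame supports
  lie in the members' supports (`frameSupp_subset_biUnion_esupp`);
* **frame agreement across two one-member extensions** (`frameIn_eq_of_goodChain₂`, `cframe_eq_of_supersets`): two structured families
  `X, X' ⊇ W₂` with at most one member outside `W₂` each give the members of `W₂` the same canonical frames — the two factorisations of
  `⋂ W₂` (T″) are rigid (`compl_notMem_of_two_factorisations`), exactly as in the tree's `frameIn_eq_of_goodChain`;
* **the coordinate shrink** (`suppZeroFlag_update_inter_coord`): if no member depends on `e`, `U ∈ Z` ⇒ `U[c ↦ U c ∩ [e open]] ∈ Z`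
  (Lemma I′ `goodChain_update_inter_of_disjoint` through `Z = structured`);
* private gluing at order two (`suppZeroFlag_glue_two`, disjoint supports).
Pure combinatorics; axioms standard. [this work]
-/

noncomputable section

open scoped Classical

namespace Summit.CriticalPhenomena.PercolationContinuityZ3.Theorems

open Finset Function
open Literature.Probability.LatticeModels.Kahn2022 (Affects)
open Literature.Probability.Percolation (DeterminedBy)

variable {ι : Type} [Fintype ι]


/-! ### Small facts: supports of hulls, glued events -/

section Small

omit [Fintype ι] in
/-- A coordinate acting on a hull acts on the event. [this work] -/
theorem affects_of_affects_hull {S : Set ι} {D : Set (Set ι)} {i : ι} (h : Affects (hull S D) i) : Affects D i := by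
  obtain ⟨ω, hω, hiω⟩ := h
  refine ⟨ω ∪ S, hω, ?_⟩
  have : insert i (ω ∪ S) = insert i ω ∪ S := by rw [Set.insert_union]
  rw [this]; exact hiω

variable {κ : Type*} (U : κ → Set (Set ι))

/-- The frame support of a chain lies in the union of the supports of its members. [this work] -/
theorem frameSupp_subset_biUnion_esupp : ∀ l : List κ, frameSupp U l ⊆ ⋃ w ∈ l, (↑(esupp (U w)) : Set ι)
  | [] => by simp [frameSupp]
  | v :: l => by
    intro i hi
    change i ∈ frameSupp U l ∪ ↑(esupp (hull (frameSupp U l) (U v))) at hi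
    rcases hi with hi | hi
    · have := frameSupp_subset_biUnion_esupp l hi
      rw [Set.mem_iUnion₂] at this ⊢
      obtain ⟨w, hw, hiw⟩ := this
      exact ⟨w, List.mem_cons_of_mem v hw, hiw⟩
    · rw [Set.mem_iUnion₂]
      exact ⟨v, List.mem_cons_self, mem_coe.2 (mem_esupp.2 (affects_of_affects_hull (mem_esupp.1 (mem_coe.1 hi))))⟩

/-- A coordinate on which no member of a chain depends is not a frame coordinate. [this work] -/
theorem notMem_frameSupp_of_forall {l : List κ} {e : ι} (h : ∀ w ∈ l, ¬ Affects (U w) e) : e ∉ frameSupp U l := by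
  intro he
  have := frameSupp_subset_biUnion_esupp U l he
  rw [Set.mem_iUnion₂] at this
  obtain ⟨w, hw, hew⟩ := this
  exact h w hw (mem_esupp.1 (mem_coe.1 hew))

omit [Fintype ι] in
/-- A coordinate acting on the glued event `A ∪ (B ∩ [e])` is `e` or acts on `A` or on `B`. [this work] -/
theorem affects_glue {A B : Set (Set ι)} {e i : ι} (h : Affects (A ∪ (B ∩ {ω | e ∈ ω})) i) : i = e ∨ Affects A i ∨ Affects B i := by
  obtain ⟨ω, hω, hiω⟩ := h
  by_cases hie : i = e
  · exact Or.inl hie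
  rcases hiω with hA | ⟨hB, he⟩
  · exact Or.inr (Or.inl ⟨ω, fun h => hω (Or.inl h), hA⟩)
  · have heω : e ∈ ω := by
      rcases (Set.mem_insert_iff.1 he) with h | h
      · exact absurd h.symm hie
      · exact h
    exact Or.inr (Or.inr ⟨ω, fun h => hω (Or.inr ⟨h, heω⟩), hB⟩)

omit [Fintype ι] in
/-- Only `e` acts on `[e open]`. [folklore] -/
theorem eq_of_affects_coord {e i : ι} (h : Affects ({ω : Set ι | e ∈ ω}) i) : i = e := by
  obtain ⟨ω, hω, hiω⟩ := h
  rcases (Set.mem_insert_iff.1 hiω) with h | h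
  · exact h.symm
  · exact absurd h hω

omit [Fintype ι] in
/-- `[e open]` is increasing. [folklore] -/
theorem isUpperSet_coord (e : ι) : IsUpperSet ({ω : Set ι | e ∈ ω}) := fun _ _ hst h => hst h

omit [Fintype ι] in
/-- **Hull of a glued event**: over coordinates not containing `e`, `hull S (A ∪ (B ∩ [e])) = hull S A ∪ (hull S B ∩ [e])`. [this work] -/
theorem hull_glue {S : Set ι} {e : ι} (he : e ∉ S) (A B : Set (Set ι)) :
    hull S (A ∪ (B ∩ {ω | e ∈ ω})) = hull S A ∪ (hull S B ∩ {ω | e ∈ ω}) := by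
  ext ω
  simp only [mem_hull, Set.mem_union, Set.mem_inter_iff, Set.mem_setOf_eq, or_false, he]

omit [Fintype ι] in
/-- **Annihilator of a glued event** lies in the union of the two annihilators. [this work] -/
theorem annihilator_glue_subset {S : Set ι} {e : ι} (he : e ∉ S) (A B : Set (Set ι)) :
    hull S (A ∪ (B ∩ {ω | e ∈ ω})) \ (A ∪ (B ∩ {ω | e ∈ ω})) ⊆ (hull S A \ A) ∪ (hull S B \ B) := by
  rw [hull_glue he]
  rintro φ ⟨h1, h2⟩
  rw [Set.mem_union, not_or] at h2
  rcases h1 with h | ⟨h, hφe⟩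
  · exact Or.inl ⟨h, h2.1⟩
  · exact Or.inr ⟨h, fun hB => h2.2 ⟨hB, hφe⟩⟩

omit [Fintype ι] in
/-- An increasing event is glued from its two `e`-sections: `X = X^{e←0} ∪ (X^{e←1} ∩ [e open])`. [folklore] -/
theorem eq_secAt_glue {X : Set (Set ι)} (hX : IsUpperSet X) (e : ι) :
    X = secAt e false X ∪ (secAt e true X ∩ {ω : Set ι | e ∈ ω}) := by
  ext ω
  simp only [Set.mem_union, Set.mem_inter_iff, Set.mem_setOf_eq, mem_secAt, forceAt, cond_false, cond_true]
  constructor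
  · intro h
    by_cases he : e ∈ ω
    · exact Or.inr ⟨by rwa [Set.insert_eq_of_mem he], he⟩
    · refine Or.inl ?_
      have h1 : ω \ {e} = ω := by
        ext i; simp only [Set.mem_sdiff, Set.mem_singleton_iff, and_iff_left_iff_imp]; rintro hi rfl; exact he hi
      rwa [h1]
  · rintro (h | ⟨h, he⟩)
    · exact hX Set.sdiff_subset h
    · rwa [Set.insert_eq_of_mem he] at h

end Small

/-! ### Frame agreement across two one-member extensions -/

section Agreement

variable {κ : Type*} (U : κ → Set (Set ι))

/-- **Frame agreement, two chains** (variant of `frameIn_eq_of_goodChain`): two good chains `l`, `l'`, both containing `W₂`, whose frames over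
`W₂` both multiply to `⋂_{W₂} U` (T″: true when each chain has at most one member outside `W₂`), give every member of `W₂` the same frame.
[Rigidity of the two factorisations of `⋂_{W₂} U`.] [this work] -/
theorem frameIn_eq_of_goodChain₂ (hU : ∀ k, IsUpperSet (U k)) (hne : ∀ k, (U k).Nonempty) {l l' : List κ} (hl : GoodChain U l)
    (hl' : GoodChain U l') {W₂ : Finset κ} (hsub : W₂ ⊆ l.toFinset) (hsub' : W₂ ⊆ l'.toFinset)
    (hprod : (⋂ w ∈ W₂, frameIn U l w) ⊆ ⋂ w ∈ W₂, U w) (hprod' : (⋂ w ∈ W₂, frameIn U l' w) ⊆ ⋂ w ∈ W₂, U w)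
    {w : κ} (hw : w ∈ W₂) : frameIn U l w = frameIn U l' w := by
  have hn := GoodChain.nodup U hl
  have hn' := GoodChain.nodup U hl'
  have hA : ∀ j ∈ W₂, IsUpperSet (frameIn U l j) := fun j _ => isUpperSet_frameIn U hU l j
  have hAne : ∀ j ∈ W₂, (frameIn U l j).Nonempty := fun j _ => frameIn_nonempty U hU hne l j
  have hAd : ∀ j ∈ W₂, ∀ j' ∈ W₂, j ≠ j' → Disjoint (esupp (frameIn U l j)) (esupp (frameIn U l j')) :=
    fun j hj j' hj' hne' => disjoint_esupp_frameIn U hn (List.mem_toFinset.1 (hsub hj)) (List.mem_toFinset.1 (hsub hj')) hne'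
  have hB : ∀ j ∈ W₂, IsUpperSet (frameIn U l' j) := fun j _ => isUpperSet_frameIn U hU l' j
  have hBne : ∀ j ∈ W₂, (frameIn U l' j).Nonempty := fun j _ => frameIn_nonempty U hU hne l' j
  have hBd : ∀ j ∈ W₂, ∀ j' ∈ W₂, j ≠ j' → Disjoint (esupp (frameIn U l' j)) (esupp (frameIn U l' j')) :=
    fun j hj j' hj' hne' => disjoint_esupp_frameIn U hn' (List.mem_toFinset.1 (hsub' hj)) (List.mem_toFinset.1 (hsub' hj')) hne'
  have eqA : (⋂ j ∈ W₂, frameIn U l j) = ⋂ j ∈ W₂, U j :=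
    Set.Subset.antisymm hprod (Set.iInter₂_mono fun j _ => subset_frameIn U hU l j)
  have eqB : (⋂ j ∈ W₂, frameIn U l' j) = ⋂ j ∈ W₂, U j :=
    Set.Subset.antisymm hprod' (Set.iInter₂_mono fun j _ => subset_frameIn U hU l' j)
  have hAB : (⋂ j ∈ W₂, frameIn U l j) = ⋂ j ∈ W₂, frameIn U l' j := eqA.trans eqB.symm
  -- across the two factorisations, blocks of different members do not meet
  have cross : ∀ a ∈ W₂, ∀ b ∈ W₂, a ≠ b → Disjoint (esupp (frameIn U l a)) (esupp (frameIn U l' b)) := by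
    intro a ha b hb hab
    rw [Finset.disjoint_iff_inter_eq_empty]
    by_contra hP
    have hPne : (esupp (frameIn U l a) ∩ esupp (frameIn U l' b)).Nonempty := nonempty_iff_ne_empty.2 hP
    have rig := compl_notMem_of_two_factorisations (fun j => frameIn U l j) W₂ (fun j => frameIn U l' j) W₂ hA hAne hAd hB hBd
      hAB ha hb hPne
    apply rig
    set P : Finset ι := esupp (frameIn U l a) ∩ esupp (frameIn U l' b) with hPdef
    have inA : ∀ u ∈ l, u ≠ a → ((↑P)ᶜ : Set ι) ∈ frameIn U l u := by
      intro u hu hua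
      refine mem_of_esupp_subset (isUpperSet_frameIn U hU l u) (frameIn_nonempty U hU hne l u) fun i hi => ?_
      rw [Set.mem_compl_iff, mem_coe, hPdef, mem_inter, not_and_or]
      left
      exact fun hia => Finset.disjoint_left.1 (disjoint_esupp_frameIn U hn hu (List.mem_toFinset.1 (hsub ha)) hua) hi hia
    have inB : ∀ u ∈ l', u ≠ b → ((↑P)ᶜ : Set ι) ∈ frameIn U l' u := by
      intro u hu hub
      refine mem_of_esupp_subset (isUpperSet_frameIn U hU l' u) (frameIn_nonempty U hU hne l' u) fun i hi => ?_
      rw [Set.mem_compl_iff, mem_coe, hPdef, mem_inter, not_and_or]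
      right
      exact fun hib => Finset.disjoint_left.1 (disjoint_esupp_frameIn U hn' hu (List.mem_toFinset.1 (hsub' hb)) hub) hi hib
    have memU : ∀ u ∈ W₂, ((↑P)ᶜ : Set ι) ∈ U u := by
      intro u hu
      by_cases hua : u = a
      · subst hua
        exact mem_of_frameFail_card_le_one U hl' hU (frameFail_card_le_one_of_forall U b inB) (List.mem_toFinset.1 (hsub' hu))
          (inB u (List.mem_toFinset.1 (hsub' hu)) hab)
      · exact mem_of_frameFail_card_le_one U hl hU (frameFail_card_le_one_of_forall U a inA)
          (List.mem_toFinset.1 (hsub hu)) (inA u (List.mem_toFinset.1 (hsub hu)) hua)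
    rw [eqA]
    exact Set.mem_iInter₂.2 memU
  -- hence the blocks agree member by member
  have key : ∀ u ∈ W₂, esupp (frameIn U l u) = esupp (frameIn U l' u) := by
    intro u hu
    apply Finset.Subset.antisymm
    · intro i hi
      have hi' : i ∈ esupp (⋂ j ∈ W₂, frameIn U l j) := subset_esupp_biInter_of_frame _ W₂ hA hAne hAd hu hi
      rw [hAB] at hi'
      have := esupp_biInter_subset (fun j => frameIn U l' j) W₂ hi'
      rw [mem_biUnion] at this
      obtain ⟨u', hu', hiu'⟩ := this
      by_cases h' : u' = u
      · subst h'; exact hiu'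
      · exact absurd hiu' (Finset.disjoint_left.1 (cross u hu u' hu' (Ne.symm h')) hi)
    · intro i hi
      have hi' : i ∈ esupp (⋂ j ∈ W₂, frameIn U l' j) := subset_esupp_biInter_of_frame _ W₂ hB hBne hBd hu hi
      rw [← hAB] at hi'
      have := esupp_biInter_subset (fun j => frameIn U l j) W₂ hi'
      rw [mem_biUnion] at this
      obtain ⟨u', hu', hiu'⟩ := this
      by_cases h' : u' = u
      · subst h'; exact hiu'
      · exact absurd hi (Finset.disjoint_left.1 (cross u' hu' u hu h') hiu')
  have others : ((W₂.erase w).biUnion fun j => esupp (frameIn U l j)) = (W₂.erase w).biUnion fun j => esupp (frameIn U l' j) :=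
    biUnion_congr rfl fun u hu => key u (mem_of_mem_erase hu)
  have fA := hull_biInter_of_frame (fun j => frameIn U l j) W₂ hA hAne hAd hw
  have fB := hull_biInter_of_frame (fun j => frameIn U l' j) W₂ hB hBne hBd hw
  rw [← fA, ← fB, hAB, others]

/-- **Canonical frames agree across two one-member extensions**: if `X ⊇ W₂` and `X' ⊇ W₂` are structured and each has at most one member
outside `W₂`, then every member of `W₂` has the same canonical frame in `X` and in `X'`. [this work] -/
theorem cframe_eq_of_supersets (hU : ∀ k, IsUpperSet (U k)) (hne : ∀ k, (U k).Nonempty) {X X' W₂ : Finset κ} (hX : Structured U X)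
    (hX' : Structured U X') (hsub : W₂ ⊆ X) (hsub' : W₂ ⊆ X') (hco : (X \ W₂).card ≤ 1) (hco' : (X' \ W₂).card ≤ 1) {w : κ}
    (hw : w ∈ W₂) : cframe U X w = cframe U X' w := by
  obtain ⟨l, hlX, hl⟩ := hX
  obtain ⟨l', hlX', hl'⟩ := hX'
  subst hlX; subst hlX'
  rw [← frameIn_eq_cframe U hU hne hl (List.mem_toFinset.1 (hsub hw)), ← frameIn_eq_cframe U hU hne hl' (List.mem_toFinset.1 (hsub' hw))]
  exact frameIn_eq_of_goodChain₂ U hU hne hl hl' hsub hsub' (biInter_frameIn_subset_biInter U hl hU W₂ hsub hco)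
    (biInter_frameIn_subset_biInter U hl' hU W₂ hsub' hco') hw

end Agreement

/-! ### The coordinate shrink and order two -/

section Coord

/-- **Shrinking one member by an independent coordinate event keeps a zero flag**: if no member of `U` depends on `e` and
`U ∈ Z_{k+2}`, then `U[c ↦ U c ∩ [e open]] ∈ Z_{k+2}` (Lemma I′ through `Z =` structured). [this work] -/
theorem suppZeroFlag_update_inter_coord {k : ℕ} (U : Fin (k + 2) → Set (Set ι)) (hU : ∀ j, IsUpperSet (U j)) (c : Fin (k + 2))
    (e : ι) (heU : ∀ j, ¬ Affects (U j) e) (hZ : SuppZeroFlag (k + 2) U) :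
    SuppZeroFlag (k + 2) (update U c (U c ∩ {ω | e ∈ ω})) := by
  set Pe : Set (Set ι) := {ω | e ∈ ω} with hPe
  have hPeU : IsUpperSet Pe := isUpperSet_coord e
  have hPene : Pe.Nonempty := ⟨Set.univ, Set.mem_univ e⟩
  by_cases hempty : ∃ j, U j = ∅
  · obtain ⟨j, hj⟩ := hempty
    by_cases hjc : j = c
    · subst hjc; exact suppZeroFlag_of_mem_empty (k + 1) _ j (by rw [update_self, hj, Set.empty_inter])
    · exact suppZeroFlag_of_mem_empty (k + 1) _ j (by rw [update_of_ne hjc, hj])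
  have hUne : ∀ j, (U j).Nonempty := fun j => Set.nonempty_iff_ne_empty.2 fun h => hempty ⟨j, h⟩
  letI : DecidableEq (Fin (k + 2) ⊕ Bool) := fun a b => Classical.propDecidable (a = b)
  set Ut : Fin (k + 2) ⊕ Bool → Set (Set ι) := Sum.elim U (fun _ => U c) with hUt
  have hUtU : ∀ x, IsUpperSet (Ut x) := by
    rintro (j | b)
    · exact hU j
    · exact hU c
  have hUtne : ∀ x, (Ut x).Nonempty := by
    rintro (j | b)
    · exact hUne j
    · exact hUne c
  have hZ' : SuppZeroFlag (k + 2) (fun j => Ut (Sum.inl j)) := hZ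
  have hSt : Structured Ut (univ.image Sum.inl) := structured_of_suppZeroFlag k Ut hUtU hUtne Sum.inl Sum.inl_injective hZ'
  obtain ⟨l, hlW, -, -, hl⟩ := Structured.exists_chain Ut hSt
  have hcl : Sum.inl c ∈ l := List.mem_toFinset.1 (by rw [hlW]; exact mem_image_of_mem _ (mem_univ c))
  have hdisj : Disjoint (↑(esupp Pe) : Set ι) (frameSupp Ut l) := by
    rw [Set.disjoint_left]; intro x hx hx'
    have hxe : x = e := eq_of_affects_coord (mem_esupp.1 (mem_coe.1 hx))
    subst hxe
    refine notMem_frameSupp_of_forall Ut (fun w hw => ?_) hx'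
    have hw' : w ∈ univ.image Sum.inl := by rw [← hlW]; exact List.mem_toFinset.2 hw
    obtain ⟨j, -, rfl⟩ := mem_image.1 hw'
    exact heU j
  have hI := (goodChain_update_inter_of_disjoint Ut hUtU hUtne hPeU hPene l.length le_rfl hl hdisj hcl).1
  have hfam : (fun j => (update Ut (Sum.inl c) (Ut (Sum.inl c) ∩ Pe)) (Sum.inl j)) = update U c (U c ∩ Pe) := by
    funext j; by_cases hj : j = c
    · subst hj; rw [update_self, update_self]; rfl
    · rw [update_of_ne hj, update_of_ne (fun h => hj (Sum.inl_injective h))]; rfl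
  have hres := suppZeroFlag_of_goodChain (update Ut (Sum.inl c) (Ut (Sum.inl c) ∩ Pe))
    (isUpperSet_update_inter_family Ut hUtU (Sum.inl c) hPeU)
    (nonempty_update_inter_family Ut hUtU hUtne (Sum.inl c) hPeU hPene) Sum.inl Sum.inl_injective hlW hI
  rwa [hfam] at hres

/-- **Private gluing at order two** (disjoint supports). [this work] -/
theorem suppZeroFlag_glue_two (U : Fin 2 → Set (Set ι)) (c : Fin 2) (A B : Set (Set ι)) (e : ι)
    (hU : ∀ j, IsUpperSet (U j)) (hA : IsUpperSet A) (hB : IsUpperSet B)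
    (heU : ∀ j, j ≠ c → ¬ Affects (U j) e) (hUc : U c = A ∪ (B ∩ {ω | e ∈ ω}))
    (hZA : SuppZeroFlag 2 (update U c A)) (hZB : SuppZeroFlag 2 (update U c B)) : SuppZeroFlag 2 U := by
  -- the other slot
  obtain ⟨d, hdc⟩ : ∃ d : Fin 2, d ≠ c := ⟨c + 1, by fin_cases c <;> decide⟩
  have hUA : ∀ j, IsUpperSet (update U c A j) := by
    intro j; by_cases hj : j = c
    · subst hj; rw [update_self]; exact hA
    · rw [update_of_ne hj]; exact hU j
  have hUB : ∀ j, IsUpperSet (update U c B j) := by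
    intro j; by_cases hj : j = c
    · subst hj; rw [update_self]; exact hB
    · rw [update_of_ne hj]; exact hU j
  -- read the two hypotheses as disjointness of supports
  have key : ∀ (F : Fin 2 → Set (Set ι)), (∀ j, IsUpperSet (F j)) →
      (SuppZeroFlag 2 F ↔ Disjoint (esupp (F c)) (esupp (F d))) := by
    intro F hF
    rw [suppZeroFlag_two_eta, suppZeroFlag_two_iff (hF 0) (hF 1)]
    fin_cases c <;> fin_cases d
    · exact absurd rfl hdc
    · exact Iff.rfl
    · exact disjoint_comm
    · exact absurd rfl hdc
  have hdA : Disjoint (esupp A) (esupp (U d)) := by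
    have := (key _ hUA).1 hZA; rwa [update_self, update_of_ne hdc] at this
  have hdB : Disjoint (esupp B) (esupp (U d)) := by
    have := (key _ hUB).1 hZB; rwa [update_self, update_of_ne hdc] at this
  refine (key U hU).2 (Finset.disjoint_left.2 fun i hi hid => ?_)
  rw [hUc, mem_esupp] at hi
  rcases affects_glue hi with h | h | h
  · subst h; exact heU d hdc (mem_esupp.1 hid)
  · exact Finset.disjoint_left.1 hdA (mem_esupp.2 h) hid
  · exact Finset.disjoint_left.1 hdB (mem_esupp.2 h) hid

end Coord

end Summit.CriticalPhenomena.PercolationContinuityZ3.Theorems
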